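import Summits.Langlands.Langlands.Theses.OrdinaryPrimeTransport
import Literature.NumberTheory.Automorphic.AutomorphicRepsGLLogDetCounterexample
import Literature.FieldTheory.AlgClosed.PadicAlgClEquivComplex

/-!
# Refutation of `OrdinaryPrimeTransport.RankinSelbergPoleCount` (item stmt-Langlands-17212)

The crux is stated for EVERY `n : ℕ` ("any n, any number field K") with no `0 < n` / `2 ≤ n` guard.
At `n = 0` all three hypotheses are satisfiable and the conclusion is `False`:

* `GL_0(𝔸_ℚ)` is the trivial group, so the constants `ℂ · 1` are cusp forms (Borel–Jacquet 4.2 (a)–(d)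
  hold trivially, the cusp condition `0 < k < 0` is empty) and `π₀ := ℂ·1 / 0` is a
  `CuspidalAutomorphicRepData 0 ℚ hcpt` whose Satake parameter at every finite place is the empty
  multiset (the only Hecke operator `[K(𝔫) t_{v,0} K(𝔫)] = [K(𝔫)]` acts as the identity);
* the trivial `ρ₀ : Γ_ℚ → GL_0(ℚ̄_2)` is unramified everywhere with `charpoly = 1 = ∏_∅`, hence
  Satake–Frobenius compatible with `π₀` at every place;
* `ρ₀.toGaloisRep.IsIrreducible` is `IsSimpleOrder (Subrepresentation _)`, which needs `⊥ ≠ ⊤` and so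
  FAILS on the zero space — `¬ IsIrreducible` holds;
* the summand hypothesis quantifies over `0 < k < 0` and is vacuous.

Classification: `refuted-misstated` — degenerate rank `n = 0`, plainly not intended (the informal text
decomposes `ρ₀^ss = ⊕ σ_i` with `m ≥ 2`). Minimal repaired statement C′: insert the guard `0 < n →`
(equivalently `2 ≤ n →`, since for `n = 1` every rank-one representation is irreducible and the second
hypothesis is unsatisfiable) right after the binder `(n : ℕ)`; the witness below does not touch C′.
[folklore]
-/

section buildfix_record -- buildfix lane 2026-08-19: re-created record(s) of dropped route item(s), see docstring(s)
open scoped BigOperators Topology Manifold Classical MeasureTheory ProbabilityTheory Matrix InnerProductSpace ComplexConjugate ContinuousMap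
open Filter Set Function TopologicalSpace MeasureTheory
namespace Summit.Langlands.Langlands.Theses.OrdinaryPrimeTransport

/-- **Record of the dropped route item `RankinSelbergPoleCount`** = stmt-Langlands-17212 (ledger signature verbatim; NOT a route
item): route OrdinaryPrimeTransport rev 11 (2026-08-16T23:48Z) dropped the refuted crux `RankinSelbergPoleCount` (refuted-misstated by the theorem below; item closed `refuted`). The declaration `Summit.Langlands.Langlands.Theses.OrdinaryPrimeTransport.RankinSelbergPoleCount`
therefore no longer exists in the route file and this accepted module stopped elaborating (stale olean;
buildfix lane 2026-08-19). Re-created here under its original name so the result keeps building; the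
statement of every previously accepted declaration in this file is unchanged. -/
def RankinSelbergPoleCount : Prop :=
  ∀ (n : ℕ) (K : Type) [Field K] [NumberField K] (hcpt : Literature.NumberTheory.Automorphic.isCompact_glFiniteIntegralLevel n K) (π : Literature.NumberTheory.Automorphic.CuspidalAutomorphicRepData n K hcpt) (ℓ₀ : ℕ) [Fact ℓ₀.Prime] (ι₀ : PadicAlgCl ℓ₀ ≃+* ℂ) (ρ₀ : Literature.NumberTheory.GaloisRepresentations.FramedGaloisRep K (PadicAlgCl ℓ₀) n), (∀ᶠ v : IsDedekindDomain.HeightOneSpectrum (NumberField.RingOfIntegers K) in Filter.cofinite, Summit.Langlands.SatakeFrobCompatibleAt ι₀ π.1 ρ₀ v) → ¬ ρ₀.toGaloisRep.IsIrreducible → (∀ (k : ℕ), 0 < k → k < n → ∀ (σ : Literature.NumberTheory.GaloisRepresentations.FramedGaloisRep K (PadicAlgCl ℓ₀) k) (τ : Literature.NumberTheory.GaloisRepresentations.FramedGaloisRep K (PadicAlgCl ℓ₀) (n - k)), σ.toGaloisRep.IsIrreducible → (∀ g : Field.absoluteGaloisGroup K, ρ₀.charpoly g = σ.charpoly g * τ.charpoly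 g) → ∃ (F' : Type) (_ : Field F') (_ : NumberField F') (_ : Algebra K F') (_ : IsGalois K F'), NumberField.IsCMField F' ∧ (σ.restrictField F').toGaloisRep.IsIrreducible ∧ ∀ (E : Type) [Field E] [NumberField E] [Algebra K E] [Algebra E F'] [IsScalarTower K E F'], IsSolvable (F' ≃ₐ[E] F') → ∃ (hE : Literature.NumberTheory.Automorphic.isCompact_glFiniteIntegralLevel k E) (P : Literature.NumberTheory.Automorphic.CuspidalAutomorphicRepData k E hE), ∀ᶠ w : IsDedekindDomain.HeightOneSpectrum (NumberField.RingOfIntegers E) in Filter.cofinite, Summit.Langlands.SatakeFrobCompatibleAt ι₀ P.1 (σ.restrictField E) w) → False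

end Summit.Langlands.Langlands.Theses.OrdinaryPrimeTransport
end buildfix_record


noncomputable section

open Literature.NumberTheory.Automorphic Literature.NumberTheory.GaloisRepresentations
open NumberField IsDedekindDomain
open scoped MatrixGroups Classical

open Summit.Langlands.Langlands.Theses.OrdinaryPrimeTransport

namespace Summit.Langlands.Langlands.Theorems

/-- Refutes `OrdinaryPrimeTransport.RankinSelbergPoleCount` [refuted-misstated]: the purity-free
Rankin–Selberg pole count is asserted for every `n : ℕ`, and at `n = 0` its hypotheses hold while its
conclusion is `False`. Witness: `n = 0`, `K = ℚ`, `π₀ = ℂ·1/0` on `GL_0(𝔸_ℚ) = 1` (Satake parameter `∅`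
everywhere), `ℓ₀ = 2`, any `ι`, `ρ₀ = 1 : Γ_ℚ → GL_0(ℚ̄_2)` (unramified, `charpoly = 1 = ∏_∅`, so
compatible everywhere; NOT irreducible since the zero space has `⊥ = ⊤`); the summand clause
`0 < k < 0` is empty. Repaired statement C′: add the guard `0 < n →` (or `2 ≤ n →`) after `(n : ℕ)`;
the witness misses C′. [folklore] -/
theorem OrdinaryPrimeTransportRankinSelbergPoleCount_refuted : ¬ RankinSelbergPoleCount := by
  intro h
  -- `GL_0(𝔸_ℚ)` is the trivial group
  haveI hsub : Subsingleton ((AdelicGroupData.gl 0 ℚ).Adelic) := by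
    change Subsingleton (GL (Fin 0) (AdeleRing (𝓞 ℚ) ℚ))
    infer_instance
  have hcpt : isCompact_glFiniteIntegralLevel 0 ℚ := isCompact_glFiniteIntegralLevel_holds 0 ℚ
  -- (1) the constant `1` is an automorphic form on `GL_0(𝔸_ℚ)` (BJ 4.2; growth with `C = 1`, `r = 0`)
  have hA : IsAutomorphicForm (AutomorphyDatum.gl 0 ℚ hcpt)
      (1 : (AdelicGroupData.gl 0 ℚ).Adelic → ℂ) :=
    { leftInvariant := isLeftInvariant_affLogDet one_eq_aff
      exists_level := by
        obtain ⟨U, hU⟩ := finiteLevelsGL_nonempty 0 ℚ hcpt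
        exact ⟨U, hU, isRightInvariantUnder_affLogDet one_eq_aff hU⟩
      archSmooth := isArchSmooth_affLogDet one_eq_aff
      kFinite := isKFinite_affLogDet one_eq_aff
      zFinite := isZFinite_affLogDet one_eq_aff
      moderateGrowth := ⟨1, 0, fun g => by simp⟩ }
  -- (2) `ℂ · 1` and `0` are stable spaces of automorphic forms, `ℂ · 1` consists of cusp forms
  have hS1 : IsStableSubmodule (AutomorphyDatum.gl 0 ℚ hcpt)
      (Submodule.span ℂ {(1 : (AdelicGroupData.gl 0 ℚ).Adelic → ℂ)}) :=
    { le_automorphicForms := Submodule.span_le.2 (by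
        rintro θ rfl
        exact hA.mem_automorphicForms)
      finite_stable := fun h' _ => span_one_le_comap_rightTranslation h'
      k_stable := fun k => span_one_le_comap_rightTranslation _
      lie_stable := fun X θ hθ => by
        obtain ⟨c, rfl⟩ := Submodule.mem_span_singleton.1 hθ
        rw [lieDeriv_smul, lieDeriv_one_gl, smul_zero]
        exact Submodule.zero_mem _ }
  have hS0 : IsStableSubmodule (AutomorphyDatum.gl 0 ℚ hcpt)
      (⊥ : Submodule ℂ ((AdelicGroupData.gl 0 ℚ).Adelic → ℂ)) :=
    { le_automorphicForms := bot_le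
      finite_stable := fun _ _ => bot_le
      k_stable := fun _ => bot_le
      lie_stable := fun X θ hθ => by
        rw [(Submodule.mem_bot ℂ).1 hθ]
        have h0 : lieDeriv (AutomorphyDatum.gl 0 ℚ hcpt).ofArch X
            (0 : (AdelicGroupData.gl 0 ℚ).Adelic → ℂ) = 0 := by
          funext g
          simp [lieDeriv]
        rw [h0]
        exact Submodule.zero_mem _ }
  have hcusp : Submodule.span ℂ {(1 : (AdelicGroupData.gl 0 ℚ).Adelic → ℂ)} ≤ cuspFormsGL 0 ℚ hcpt := by
    refine Submodule.span_le.2 ?_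
    rintro θ rfl
    exact IsCuspFormGL.mem_cuspFormsGL ⟨hA, fun k hk hk0 => absurd hk0 (by omega)⟩
  -- (3) the cuspidal datum `π₀ = ℂ · 1 / 0` (a line, hence irreducible)
  obtain ⟨π₀, hW, hW'⟩ : ∃ π₀ : CuspidalAutomorphicRepData 0 ℚ hcpt,
      π₀.1.W = Submodule.span ℂ {(1 : (AdelicGroupData.gl 0 ℚ).Adelic → ℂ)} ∧ π₀.1.W' = ⊥ :=
    ⟨⟨{ W := Submodule.span ℂ {(1 : (AdelicGroupData.gl 0 ℚ).Adelic → ℂ)}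
        W' := ⊥
        lt := bot_lt_iff_ne_bot.2 (by
          rw [Ne, Submodule.span_singleton_eq_bot]
          exact one_ne_zero)
        stable := hS1
        stable' := hS0
        irreducible := fun W'' _ h₂ _ =>
          (nonzero_span_atom (1 : (AdelicGroupData.gl 0 ℚ).Adelic → ℂ) one_ne_zero).le_iff.1 h₂ },
      hcusp⟩, rfl, rfl⟩
  -- (4) on the trivial group every double-coset Hecke operator `[U g U] = [U]` is the identity
  have hHecke : ∀ (U : Subgroup (AdelicGroupData.gl 0 ℚ).Adelic) (g : (AdelicGroupData.gl 0 ℚ).Adelic)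
      (φ : (AdelicGroupData.gl 0 ℚ).Adelic → ℂ),
      heckeOperator (rightTranslation (AdelicGroupData.gl 0 ℚ)) U g φ = φ := by
    intro U g φ
    have hφ : φ ∈ (rightTranslation (AdelicGroupData.gl 0 ℚ)).fixedPoints U := by
      rw [← isRightInvariantUnder_iff_mem_fixedPoints]
      intro u _ x
      rw [Subsingleton.elim (x * u) x]
    have hall : ∀ y : (AdelicGroupData.gl 0 ℚ).Adelic ⧸ U,
        y = ((1 : (AdelicGroupData.gl 0 ℚ).Adelic) : (AdelicGroupData.gl 0 ℚ).Adelic ⧸ U) :=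
      fun y => QuotientGroup.induction_on y fun z => congrArg _ (Subsingleton.elim z 1)
    have hs : Set.BijOn (fun x : (AdelicGroupData.gl 0 ℚ).Adelic => (x : (AdelicGroupData.gl 0 ℚ).Adelic ⧸ U))
        (({1} : Finset (AdelicGroupData.gl 0 ℚ).Adelic) : Set (AdelicGroupData.gl 0 ℚ).Adelic)
        (MulAction.orbit U (g : (AdelicGroupData.gl 0 ℚ).Adelic ⧸ U)) := by
      refine ⟨?_, ?_, ?_⟩
      · intro x _
        show (x : (AdelicGroupData.gl 0 ℚ).Adelic ⧸ U) ∈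
          MulAction.orbit U (g : (AdelicGroupData.gl 0 ℚ).Adelic ⧸ U)
        rw [hall (x : (AdelicGroupData.gl 0 ℚ).Adelic ⧸ U), ← hall (g : (AdelicGroupData.gl 0 ℚ).Adelic ⧸ U)]
        exact MulAction.mem_orbit_self _
      · simp
      · intro y _
        exact ⟨1, Finset.mem_coe.2 (Finset.mem_singleton_self _), (hall y).symm⟩
    rw [heckeOperator_apply_eq_sum _ U g {1} hs hφ, Finset.sum_singleton, map_one, Module.End.one_apply]
  -- (5) `π₀` has the empty Satake parameter at every finite place (level `1`, eigenform `1`)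
  have hSat : ∀ v : HeightOneSpectrum (𝓞 ℚ), π₀.1.HasSatakeParamAt v 0 := by
    intro v
    obtain ⟨ϖ₀, hϖ₀⟩ := v.valuation_exists_uniformizer ℚ
    have hval' : Valued.v (algebraMap ℚ (v.adicCompletion ℚ) ϖ₀) = v.valuation ℚ ϖ₀ :=
      HeightOneSpectrum.valuedAdicCompletion_eq_valuation' v ϖ₀
    have hval : Valued.v (algebraMap ℚ (v.adicCompletion ℚ) ϖ₀) = WithZero.exp (-1 : ℤ) := by
      rw [hval', hϖ₀]
    have hne : algebraMap ℚ (v.adicCompletion ℚ) ϖ₀ ≠ 0 := fun h0 => by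
      rw [h0, map_zero] at hval
      exact WithZero.coe_ne_zero hval.symm
    refine ⟨⊤, Units.mk0 _ hne, ?_, ?_, hval, rfl, 1, ?_, ?_, ?_, ?_⟩
    · simp
    · intro hdvd
      exact v.isPrime.ne_top (top_le_iff.1 (Ideal.dvd_iff_le.1 hdvd))
    · rw [hW]
      exact Submodule.mem_span_singleton_self _
    · rw [hW', Submodule.mem_bot]
      exact one_ne_zero
    · intro u _
      rfl
    · intro i hi
      obtain rfl : i = 0 := Nat.le_zero.1 hi
      rw [hW', Submodule.mem_bot, hHecke]
      have h1 : ((((Real.sqrt (v.residueCard : ℝ)) : ℝ) : ℂ) ^ (0 * (0 - 0)) *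
          (0 : Multiset ℂ).esymm 0) = 1 := by
        simp [Multiset.esymm]
      rw [h1, one_smul, sub_self]
  -- (6) the Galois side: `ρ₀ = 1` in rank `0` is compatible everywhere and not irreducible
  haveI : Fact (Nat.Prime 2) := ⟨Nat.prime_two⟩
  obtain ⟨ι⟩ := PadicAlgCl.nonempty_ringEquiv_complex 2
  refine h 0 ℚ hcpt π₀ 2 ι (1 : FramedGaloisRep ℚ (PadicAlgCl 2) 0) ?_ ?_ ?_
  · refine Filter.Eventually.of_forall fun v => ⟨0, hSat v, ?_, ?_⟩
    · intro 𝔓 _ σ _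
      rfl
    · intro 𝔓 _ σ _
      have h1 : arithFrobPolyOfSatake ι v.residueCard 1 (0 : Multiset ℂ) = 1 := by
        simp [arithFrobPolyOfSatake]
      rw [h1]
      unfold FramedRep.charpoly
      simp [Matrix.charpoly]
  · -- `IsSimpleOrder` needs `⊥ ≠ ⊤`, but the zero space has a single subrepresentation
    intro hirr
    obtain ⟨W₁, W₂, hne⟩ := hirr.toNontrivial
    exact hne (Subrepresentation.toSubmodule_injective (Subsingleton.elim _ _))
  · intro k hk hk0
    exact absurd hk0 (Nat.not_lt_zero k)

end Summit.Langlands.Langlands.Theorems
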